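import Mathlib.Analysis.InnerProductSpace.Calculus
import Literature.Geometry.Lorentzian.Genericity
import Literature.Geometry.Lorentzian.AsymptoticFlatness
import HarnessLib

/-!
# Smooth one-parameter families of initial data by eventual constancy (route `SwallowTheDatum`,
# crux `ParametricKerrBurial`, item stmt-FinalStateConjecture-10052) — support lemmas

The crux `Summit.FinalStateConjecture.FinalStateConjecture.Theses.SwallowTheDatum.ParametricKerrBurial`
asks, for every admissible datum `d` on `X`, for a family `F : ℝ¹ → InitialDataSet (𝓡 3) X` which
is a smooth one-parameter family in the typed sense `InitialDataSet.IsSmoothDataFamily 1 F`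
(`Genericity.lean`: joint `C^∞`-ness of `(c, x) ↦ h_c(x)` and `(c, x) ↦ k_c(x)` on `ℝ¹ × X`, and
nothing else), passes through `d` at `c = 0`, and whose members `F c`, `c ≠ 0`, are Kerr-shielded.
Every construction proposed for the crux (route thesis "FlatTransport"; crux idea cards
`receding-annulus-universal-collar`, `universal-coffin-mass-jump`, `null-shell-shadow-collar`,
`trapped-target-null-gluing`) obtains the member `F c` from a RADIUS-indexed family `G R` of data
which agree with `d` off the far region `e.far R` of an asymptotically flat end `e`, by a
reparametrisation `R = ρ(c) → ∞` as `c → 0`.  The smoothness of such an `F` AT `c = 0` is then a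
matter of locality alone ("eventual constancy": near every point of `X` the family is eventually
equal to `d`).  This file proves that step once and for all:

* `isSmoothDataFamily_of_eventuallyEq` — a family which is jointly smooth off the parameter `0` and
  eventually constant (in the filter sense) at every `(0, x₀)` is an `IsSmoothDataFamily`
  (any number `m` of parameters, any model `I`);
* `eventualConstancySmooth` — the same in the `∃ V ∈ 𝓝 x₀, ∃ ε > 0, …` form in which the crux
  sketches state it (`EventualConstancySmooth` of `Cruxes/ParametricKerrBurial/IdeaSketch-ideator2.lean`
  is this theorem verbatim);
* `AFEnd.exists_nhds_forall_not_mem_far` — every point of `X` has a neighbourhood missing the far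
  regions `e.far R` of an asymptotically flat end for all large `R`;
* `isSmoothDataFamily_reparam_of_agree_off_far` — if `G : ℝ → InitialDataSet (𝓡 3) X` is jointly
  smooth on `{Rstar < R} × X` and `G R = d` off `e.far R` (`Rstar < R`), and `ρ : ℝ¹ → ℝ` is smooth
  off `0`, `> Rstar` off `0` and tends to `+∞` at `0`, then `c ↦ G (ρ c)` (`c ≠ 0`), `0 ↦ d` is an
  `IsSmoothDataFamily` through `d`.

What is NOT here (recorded as evidence on the item): injectivity of the reparametrised family.
With ONE radius-indexed family `G` it cannot be had — any two continuous reparametrisations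
`ρ : (0, ε) → ℝ`, `ρ' : (−ε, 0) → ℝ` tending to `+∞` at `0` have overlapping ranges, so
`c ↦ G (ρ c)` identifies some `c > 0` with some `c' < 0`; the architecture needs a second,
distinguishable branch for `c < 0` (see the item's evidence note `transfer-injectivity-gap.md`).

Mathlib: `ContMDiffAt.congr_of_eventuallyEq`, `ContMDiffOn.contMDiffAt`, `ContMDiffOn.comp`,
`contMDiffOn_fst/snd`, `nhds_prod_eq`; tree: `InitialDataSet.IsSmoothDataFamily`
(`Genericity.lean`), `AFEnd.far`, `AFEnd.isClosed_far` (`AsymptoticFlatness.lean`).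
-/

noncomputable section

open scoped Manifold ContDiff Topology
open Bundle Set Filter Literature.Geometry.Lorentzian

namespace Summit.FinalStateConjecture.FinalStateConjecture.Theorems.SwallowTheDatum

/-! ### Eventual constancy at the parameter `0` gives a smooth family -/

section General

variable {E : Type*} [NormedAddCommGroup E] [NormedSpace ℝ E] {H : Type*} [TopologicalSpace H]
  {I : ModelWithCorners ℝ E H} {X : Type*} [TopologicalSpace X] [ChartedSpace H X]
  [IsManifold I ∞ X]

/-- **Eventual constancy ⇒ smooth family** (filter form, any number of parameters). Let
`F : ℝᵐ → InitialDataSet I X`. If `(c, x) ↦ h_c(x)` and `(c, x) ↦ k_c(x)` are `C^∞` on the open set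
`{c ≠ 0} × X` (as maps into the bundle of bilinear forms, exactly as in
`InitialDataSet.IsSmoothDataFamily`), and for every `x₀ ∈ X` one has `h_c(x) = h_0(x)` and
`k_c(x) = k_0(x)` for all `(c, x)` near `(0, x₀)`, then `F` is a smooth `m`-parameter family.
Proof: smoothness is local; near `(0, x₀)` the two section maps agree with those of the constant
family `c ↦ F 0`, which are smooth (`InitialDataSet.isSmoothDataFamily_const`). [folklore] -/
theorem isSmoothDataFamily_of_eventuallyEq {m : ℕ}
    {F : EuclideanSpace ℝ (Fin m) → InitialDataSet I X}
    (hh : ContMDiffOn (𝓘(ℝ, EuclideanSpace ℝ (Fin m)).prod I) (I.prod 𝓘(ℝ, E →L[ℝ] E →L[ℝ] ℝ)) ∞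
        (fun p : EuclideanSpace ℝ (Fin m) × X ↦
          TotalSpace.mk' (F := E →L[ℝ] E →L[ℝ] ℝ)
            (E := fun x : X ↦ TangentSpace I x →L[ℝ] TangentSpace I x →L[ℝ] ℝ) p.2
            ((F p.1).h.inner p.2)) {p | p.1 ≠ 0})
    (hk : ContMDiffOn (𝓘(ℝ, EuclideanSpace ℝ (Fin m)).prod I) (I.prod 𝓘(ℝ, E →L[ℝ] E →L[ℝ] ℝ)) ∞
        (fun p : EuclideanSpace ℝ (Fin m) × X ↦
          TotalSpace.mk' (F := E →L[ℝ] E →L[ℝ] ℝ)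
            (E := fun x : X ↦ TangentSpace I x →L[ℝ] TangentSpace I x →L[ℝ] ℝ) p.2
            ((F p.1).k p.2)) {p | p.1 ≠ 0})
    (hloc : ∀ x₀ : X, ∀ᶠ p in 𝓝 ((0 : EuclideanSpace ℝ (Fin m)), x₀),
        (F p.1).h.inner p.2 = (F 0).h.inner p.2 ∧ (F p.1).k p.2 = (F 0).k p.2) :
    InitialDataSet.IsSmoothDataFamily m F := by
  have hopen : IsOpen {p : EuclideanSpace ℝ (Fin m) × X | p.1 ≠ 0} :=
    isOpen_ne.preimage continuous_fst
  obtain ⟨hch, hck⟩ := InitialDataSet.isSmoothDataFamily_const m (F 0)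
  refine ⟨fun p ↦ ?_, fun p ↦ ?_⟩
  · by_cases hp : p.1 = 0
    · have hp' : p = (0, p.2) := Prod.ext hp rfl
      refine (hch p).congr_of_eventuallyEq ?_
      rw [hp']
      filter_upwards [hloc p.2] with q hq
      simp only [hq.1]
    · exact hh.contMDiffAt (hopen.mem_nhds hp)
  · by_cases hp : p.1 = 0
    · have hp' : p = (0, p.2) := Prod.ext hp rfl
      refine (hck p).congr_of_eventuallyEq ?_
      rw [hp']
      filter_upwards [hloc p.2] with q hq
      simp only [hq.2]
    · exact hk.contMDiffAt (hopen.mem_nhds hp)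

/-- **Eventual constancy ⇒ smooth family** (neighbourhood form, any number of parameters): as
`isSmoothDataFamily_of_eventuallyEq`, with the hypothesis at `c = 0` stated as "every `x₀` has a
neighbourhood `V` and an `ε > 0` such that `F c` and `F 0` have the same `h` and `k` on `V`
whenever `‖c‖ < ε`". [folklore] -/
theorem isSmoothDataFamily_of_locally_eventually_const {m : ℕ}
    {F : EuclideanSpace ℝ (Fin m) → InitialDataSet I X}
    (hh : ContMDiffOn (𝓘(ℝ, EuclideanSpace ℝ (Fin m)).prod I) (I.prod 𝓘(ℝ, E →L[ℝ] E →L[ℝ] ℝ)) ∞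
        (fun p : EuclideanSpace ℝ (Fin m) × X ↦
          TotalSpace.mk' (F := E →L[ℝ] E →L[ℝ] ℝ)
            (E := fun x : X ↦ TangentSpace I x →L[ℝ] TangentSpace I x →L[ℝ] ℝ) p.2
            ((F p.1).h.inner p.2)) {p | p.1 ≠ 0})
    (hk : ContMDiffOn (𝓘(ℝ, EuclideanSpace ℝ (Fin m)).prod I) (I.prod 𝓘(ℝ, E →L[ℝ] E →L[ℝ] ℝ)) ∞
        (fun p : EuclideanSpace ℝ (Fin m) × X ↦
          TotalSpace.mk' (F := E →L[ℝ] E →L[ℝ] ℝ)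
            (E := fun x : X ↦ TangentSpace I x →L[ℝ] TangentSpace I x →L[ℝ] ℝ) p.2
            ((F p.1).k p.2)) {p | p.1 ≠ 0})
    (hloc : ∀ x₀ : X, ∃ V ∈ 𝓝 x₀, ∃ ε > (0 : ℝ), ∀ c : EuclideanSpace ℝ (Fin m), ‖c‖ < ε →
        ∀ x ∈ V, (F c).h.inner x = (F 0).h.inner x ∧ (F c).k x = (F 0).k x) :
    InitialDataSet.IsSmoothDataFamily m F := by
  refine isSmoothDataFamily_of_eventuallyEq hh hk fun x₀ ↦ ?_
  obtain ⟨V, hV, ε, hε, hVε⟩ := hloc x₀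
  have hc : ∀ᶠ c in 𝓝 (0 : EuclideanSpace ℝ (Fin m)), ‖c‖ < ε := by
    filter_upwards [Metric.ball_mem_nhds (0 : EuclideanSpace ℝ (Fin m)) hε] with c hc
    rwa [Metric.mem_ball, dist_zero_right] at hc
  have h2 : ∀ᶠ p in 𝓝 ((0 : EuclideanSpace ℝ (Fin m)), x₀), ‖p.1‖ < ε ∧ p.2 ∈ V := by
    rw [nhds_prod_eq]
    exact hc.prod_mk hV
  filter_upwards [h2] with p hp
  exact hVε p.1 hp.1 p.2 hp.2

end General

/-! ### The crux sketches' `EventualConstancySmooth`, verbatim -/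

/-- `EventualConstancySmooth` of the crux sketch `Cruxes/ParametricKerrBurial/IdeaSketch-ideator2.lean`
(cards `receding-annulus-universal-collar`, `null-shell-shadow-collar`), verbatim: for data on a
`3`-manifold modelled on `E3` and one real parameter, joint smoothness off `c = 0` plus local
eventual constancy at `c = 0` give `IsSmoothDataFamily 1 F`. [folklore] -/
theorem eventualConstancySmooth :
    ∀ (X : Type) [TopologicalSpace X] [ChartedSpace E3 X] [IsManifold (𝓡 3) ((⊤ : ℕ∞) : WithTop ℕ∞) X]
      (F : EuclideanSpace ℝ (Fin 1) → InitialDataSet (𝓡 3) X),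
      ContMDiffOn (𝓘(ℝ, EuclideanSpace ℝ (Fin 1)).prod (𝓡 3)) ((𝓡 3).prod 𝓘(ℝ, E3 →L[ℝ] E3 →L[ℝ] ℝ)) ∞
          (fun p : EuclideanSpace ℝ (Fin 1) × X ↦
            TotalSpace.mk' (F := E3 →L[ℝ] E3 →L[ℝ] ℝ)
              (E := fun x : X ↦ TangentSpace (𝓡 3) x →L[ℝ] TangentSpace (𝓡 3) x →L[ℝ] ℝ) p.2
              ((F p.1).h.inner p.2)) {p | p.1 ≠ 0} →
      ContMDiffOn (𝓘(ℝ, EuclideanSpace ℝ (Fin 1)).prod (𝓡 3)) ((𝓡 3).prod 𝓘(ℝ, E3 →L[ℝ] E3 →L[ℝ] ℝ)) ∞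
          (fun p : EuclideanSpace ℝ (Fin 1) × X ↦
            TotalSpace.mk' (F := E3 →L[ℝ] E3 →L[ℝ] ℝ)
              (E := fun x : X ↦ TangentSpace (𝓡 3) x →L[ℝ] TangentSpace (𝓡 3) x →L[ℝ] ℝ) p.2
              ((F p.1).k p.2)) {p | p.1 ≠ 0} →
      (∀ x₀ : X, ∃ V ∈ 𝓝 x₀, ∃ ε > (0 : ℝ), ∀ c : EuclideanSpace ℝ (Fin 1), ‖c‖ < ε →
          ∀ x ∈ V, (F c).h.inner x = (F 0).h.inner x ∧ (F c).k x = (F 0).k x) →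
      InitialDataSet.IsSmoothDataFamily 1 F :=
  fun _X _ _ _ _F hh hk hloc ↦ isSmoothDataFamily_of_locally_eventually_const hh hk hloc

/-! ### Far regions of an asymptotically flat end recede from every point -/

section Far

variable {X : Type*} [TopologicalSpace X] [ChartedSpace E3 X]

/-- Every point `x₀` of `X` has a neighbourhood `V` which misses the far regions `e.far R` of an
asymptotically flat end `e` for all `R ≥ R₀`: if `x₀` lies in the end, take the points of chart
radius `< ‖chart x₀‖ + 1`; otherwise the complement of the closed set `{e.R + 1 ≤ ‖chart ·‖}`
(`AFEnd.isClosed_far`). Bartnik 1986, §1 (the exhaustion by the sets `E_R`). [folklore] -/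
theorem AFEnd.exists_nhds_forall_not_mem_far (e : AFEnd X) (x₀ : X) :
    ∃ V ∈ 𝓝 x₀, ∃ R₀ : ℝ, ∀ R, R₀ ≤ R → ∀ x ∈ V, x ∉ e.far R := by
  by_cases hx₀ : x₀ ∈ (e.U : Set X)
  · -- inside the end: bound the chart radius on a neighbourhood
    set u₀ : e.U := ⟨x₀, hx₀⟩ with hu₀
    set ρ₀ : ℝ := ‖(e.chart u₀ : E3)‖ with hρ₀
    -- the open set of points of the end with chart radius `< ρ₀ + 1`
    let W : Set e.U := e.chart ⁻¹' {y | ‖(y : E3)‖ < ρ₀ + 1}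
    have hWo : IsOpen W :=
      (isOpen_lt (continuous_norm.comp continuous_subtype_val) continuous_const).preimage
        e.chart.continuous
    have hVo : IsOpen (((↑) : e.U → X) '' W) := e.U.isOpen.isOpenMap_subtype_val _ hWo
    refine ⟨((↑) : e.U → X) '' W, hVo.mem_nhds ⟨u₀, ?_, rfl⟩, ρ₀ + 1, fun R hR x hx hfar ↦ ?_⟩
    · show ‖(e.chart u₀ : E3)‖ < ρ₀ + 1
      linarith
    · obtain ⟨u, hu, rfl⟩ := hx
      obtain ⟨u', hu', huu'⟩ := hfar
      have : u' = u := Subtype.val_injective huu'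
      subst this
      have h1 : ‖(e.chart u' : E3)‖ < ρ₀ + 1 := hu
      have h2 : R < ‖(e.chart u' : E3)‖ := hu'
      linarith
  · -- outside the end: the complement of the closed set `{e.R + 1 ≤ ‖chart ·‖}`
    have hcl := e.isClosed_far (e.R + 1) (by linarith [e.R_pos])
    refine ⟨(((↑) : e.U → X) '' (e.chart ⁻¹' {y | e.R + 1 ≤ ‖(y : E3)‖}))ᶜ,
      hcl.isOpen_compl.mem_nhds ?_, e.R + 1, fun R hR x hx hfar ↦ ?_⟩
    · rintro ⟨u, -, rfl⟩
      exact hx₀ u.2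
    · obtain ⟨u, hu, rfl⟩ := hfar
      refine hx ⟨u, ?_, rfl⟩
      have h2 : R < ‖(e.chart u : E3)‖ := hu
      show e.R + 1 ≤ ‖(e.chart u : E3)‖
      linarith

end Far

/-! ### Radius-indexed exhaustions give smooth families through `d` -/

section Reparam

variable {X : Type*} [TopologicalSpace X] [ChartedSpace E3 X] [IsManifold (𝓡 3) ∞ X]

/-- **Reparametrised exhaustions are smooth families through `d`.** Let `G : ℝ → InitialDataSet (𝓡 3) X`
be jointly smooth in `(R, x)` on `{Rstar < R} × X` and agree with `d` off the far region `e.far R`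
of an asymptotically flat end for every `R > Rstar`; let `ρ : ℝ¹ → ℝ` be `C^∞` on `{c ≠ 0}`, with
`Rstar < ρ c` for `c ≠ 0` and `ρ c → +∞` as `c → 0`, `c ≠ 0`. Then the family `F c := G (ρ c)`
(`c ≠ 0`), `F 0 := d` is a smooth one-parameter family in the typed sense (and trivially
`F 0 = d`). This is the `c = 0` step ("eventual constancy", "FlatTransport") shared by the route's
intended proof and the crux cards for `ParametricKerrBurial`; no rate of convergence, uniformity or
transport of manifolds is involved. [folklore] -/
theorem isSmoothDataFamily_reparam_of_agree_off_far (d : InitialDataSet (𝓡 3) X) (e : AFEnd X)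
    (Rstar : ℝ) (G : ℝ → InitialDataSet (𝓡 3) X) (ρ : EuclideanSpace ℝ (Fin 1) → ℝ)
    (hGh : ContMDiffOn (𝓘(ℝ, ℝ).prod (𝓡 3)) ((𝓡 3).prod 𝓘(ℝ, E3 →L[ℝ] E3 →L[ℝ] ℝ)) ∞
        (fun p : ℝ × X ↦
          TotalSpace.mk' (F := E3 →L[ℝ] E3 →L[ℝ] ℝ)
            (E := fun x : X ↦ TangentSpace (𝓡 3) x →L[ℝ] TangentSpace (𝓡 3) x →L[ℝ] ℝ) p.2
            ((G p.1).h.inner p.2)) {p | Rstar < p.1})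
    (hGk : ContMDiffOn (𝓘(ℝ, ℝ).prod (𝓡 3)) ((𝓡 3).prod 𝓘(ℝ, E3 →L[ℝ] E3 →L[ℝ] ℝ)) ∞
        (fun p : ℝ × X ↦
          TotalSpace.mk' (F := E3 →L[ℝ] E3 →L[ℝ] ℝ)
            (E := fun x : X ↦ TangentSpace (𝓡 3) x →L[ℝ] TangentSpace (𝓡 3) x →L[ℝ] ℝ) p.2
            ((G p.1).k p.2)) {p | Rstar < p.1})
    (hagree : ∀ R, Rstar < R → ∀ x ∉ e.far R, (G R).h.inner x = d.h.inner x ∧ (G R).k x = d.k x)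
    (hρ : ContDiffOn ℝ ∞ ρ {c | c ≠ 0}) (hρ' : ∀ c ≠ 0, Rstar < ρ c)
    (hρ0 : Tendsto ρ (𝓝[≠] 0) atTop) :
    InitialDataSet.IsSmoothDataFamily 1
      (fun c : EuclideanSpace ℝ (Fin 1) ↦ if c = 0 then d else G (ρ c)) := by
  -- the reparametrisation map `(c, x) ↦ (ρ c, x)` is smooth on `{c ≠ 0} × X` into `{Rstar < R} × X`
  have hP : ContMDiffOn (𝓘(ℝ, EuclideanSpace ℝ (Fin 1)).prod (𝓡 3)) (𝓘(ℝ, ℝ).prod (𝓡 3)) ∞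
      (fun p : EuclideanSpace ℝ (Fin 1) × X ↦ (ρ p.1, p.2)) {p | p.1 ≠ 0} := by
    refine ContMDiffOn.prodMk ?_ contMDiffOn_snd
    exact (hρ.contMDiffOn.comp contMDiffOn_fst fun p hp ↦ hp)
  have hmaps : MapsTo (fun p : EuclideanSpace ℝ (Fin 1) × X ↦ (ρ p.1, p.2)) {p | p.1 ≠ 0}
      {p : ℝ × X | Rstar < p.1} := fun p hp ↦ hρ' p.1 hp
  refine isSmoothDataFamily_of_eventuallyEq ?_ ?_ ?_
  · refine ((hGh.comp hP hmaps).congr fun p hp ↦ ?_)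
    have hp' : p.1 ≠ 0 := hp
    simp only [Function.comp_apply, if_neg hp']
  · refine ((hGk.comp hP hmaps).congr fun p hp ↦ ?_)
    have hp' : p.1 ≠ 0 := hp
    simp only [Function.comp_apply, if_neg hp']
  · intro x₀
    obtain ⟨V, hV, R₀, hR₀⟩ := AFEnd.exists_nhds_forall_not_mem_far e x₀
    -- near `c = 0`, `c ≠ 0`: `ρ c ≥ R₀`
    have hc : ∀ᶠ c in 𝓝 (0 : EuclideanSpace ℝ (Fin 1)), c ≠ 0 → R₀ ≤ ρ c := by
      have := (hρ0.eventually (eventually_ge_atTop R₀))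
      exact eventually_nhdsWithin_iff.mp this
    have h2 : ∀ᶠ p in 𝓝 ((0 : EuclideanSpace ℝ (Fin 1)), x₀), (p.1 ≠ 0 → R₀ ≤ ρ p.1) ∧ p.2 ∈ V := by
      rw [nhds_prod_eq]
      exact hc.prod_mk hV
    filter_upwards [h2] with ⟨c, x⟩ hp
    by_cases hc0 : c = 0
    · subst hc0
      exact ⟨rfl, rfl⟩
    · have hfar : x ∉ e.far (ρ c) := hR₀ _ (hp.1 hc0) _ hp.2
      obtain ⟨hh', hk'⟩ := hagree (ρ c) (hρ' _ hc0) x hfar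
      simp only [if_neg hc0, if_pos]
      exact ⟨hh', hk'⟩

/-- The standard reparametrisation `ρ c = R₁ + ‖c‖⁻²` (`R₁ > Rstar` arbitrary) meets the three
hypotheses of `isSmoothDataFamily_reparam_of_agree_off_far`: it is `C^∞` off `0`, exceeds `Rstar`
off `0`, and tends to `+∞` at `0`. [folklore] -/
theorem reparam_inv_norm_sq (Rstar R₁ : ℝ) (hR₁ : Rstar < R₁) :
    ContDiffOn ℝ ∞ (fun c : EuclideanSpace ℝ (Fin 1) ↦ R₁ + (‖c‖ ^ 2)⁻¹) {c | c ≠ 0} ∧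
    (∀ c : EuclideanSpace ℝ (Fin 1), c ≠ 0 → Rstar < R₁ + (‖c‖ ^ 2)⁻¹) ∧
    Tendsto (fun c : EuclideanSpace ℝ (Fin 1) ↦ R₁ + (‖c‖ ^ 2)⁻¹) (𝓝[≠] 0) atTop := by
  refine ⟨?_, fun c hc ↦ ?_, ?_⟩
  · refine contDiffOn_const.add ?_
    refine ContDiffOn.inv ?_ fun c hc ↦ ?_
    · exact (contDiff_norm_sq ℝ).contDiffOn
    · have : c ≠ 0 := hc
      positivity
  · have : 0 < (‖c‖ ^ 2)⁻¹ := by positivity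
    linarith
  · refine tendsto_atTop_add_const_left _ R₁ ?_
    refine Tendsto.inv_tendsto_nhdsGT_zero ?_
    -- `‖c‖² → 0` within `{c ≠ 0}`, with positive values
    refine tendsto_nhdsWithin_iff.mpr ⟨?_, ?_⟩
    · have : Tendsto (fun c : EuclideanSpace ℝ (Fin 1) ↦ ‖c‖ ^ 2) (𝓝 0) (𝓝 0) := by
        have h := (tendsto_norm_zero (E := EuclideanSpace ℝ (Fin 1))).pow 2
        simpa using h
      exact this.mono_left nhdsWithin_le_nhds
    · refine eventually_nhdsWithin_of_forall fun c hc ↦ ?_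
      have : c ≠ 0 := hc
      show 0 < ‖c‖ ^ 2
      positivity

end Reparam

end Summit.FinalStateConjecture.FinalStateConjecture.Theorems.SwallowTheDatum

end
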